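import Summits.CriticalPhenomena.CardyFormulaZ2.Theorems.CardyComplexConeSLESixFamiliesGiveCardyLowerRunPart2

/-!
# Stub `stub_lowerRun` of line `collar-touch-sandwich` (crux `SLESixFamiliesGiveCardy`,
stmt-CriticalPhenomena-9654): the lower run inclusion `LowerRun`

`theorem stub_lowerRun : LowerRun` (registered stub B of the checked skeleton
`Cruxes/SLESixFamiliesGiveCardy/Lines/collar-touch-sandwich.lean`; statement in the definitions
module `Theorems/CardyComplexConeSLESixFamiliesGiveCardyDefs.lean`): under `LowerCollarGeom R D G`,
for every square-lattice discretisation family `Λ` of the collared Dobrushin domain `D ⊇ Ω` and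
every `η > 0`, for all small meshes `δ` every bond configuration whose medial exploration trace in
`Λ δ` stays `η`-away from the touch set `G` has a free open crossing of `Ω_δ` from `(ab)_δ` to
`(cd)_δ` (`discreteCrossing Ω δ (R.arc 0) (R.arc 2)`).

The proof is `H`-free, RSW-free and uses no planar topology: `lowerRun_kernel` is the
deterministic statement at one admissible mesh (open chain of left vertices from the `C₂`-collar
to the `C₀`-collar, run extraction `PathIn.exists_run` between the last `C₂`-contact and the next
`C₀`-contact, gates are discrete-arc sites, the run lies in the giant component because its gates
are `≥ r/2` apart, inside steps are `ω`-open because wired sites in `Ω` are `η/2`-close to `G`);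
`stub_lowerRun` intersects the eventualities supplied by Part 1 (`lowerRun_wired_near_touch`,
`eventually_zdABEdges_near_pt`), the family guards and
`JordanDomain.exists_mem_meshDomain_and_mem_of_reachable`.

References: S. Smirnov, C. R. Acad. Sci. Paris 333 (2001), §2; G. Grimmett, *Percolation*
(1999), §11.2.
-/

noncomputable section

open Set Filter Topology Metric MeasureTheory
open scoped NNReal
open Literature.Probability Literature.Probability.RandomPlanarGeometry
  Literature.Probability.LatticeModels Literature.Probability.Percolation

namespace Summit.CriticalPhenomena.CardyFormulaZ2.Cruxes.SLESixFamiliesGiveCardy.CollarTouchSandwich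

/-! ### The deterministic kernel at one mesh -/

/-- **Deterministic kernel of the lower run inclusion.**  At ONE admissible mesh: let `E` be
admissible Dobrushin data on a domain `E.Ω` whose part `E.Ω ∖ Ω` outside the carrier `Ω` of
the conformal rectangle `R` lies in two closed collars `C₀`, `C₂` disjoint from `Ω`, `≥ r`
apart, `C₀` (`C₂`) at distance `≥ r` from the arcs other than `R.arc 0` (`R.arc 2`), with
`E.Ω ∩ B(p₀, r) ⊆ C₂`, `E.Ω ∩ B(p₁, r) ⊆ C₀` for two points `p₀, p₁` at distance `≥ 2ε₀`
(`2ε₀ ≤ r`) each having an `A`–`B` edge midpoint within `ε₀`; assume `4δ < r`, the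
giant-component property of `Ω_δ` at scale `r/2`, and that wired sites with mesh point in `Ω`
are `η/2`-close to a nonempty set `G` (`2δ < η`).  Then every configuration whose exploration
trace avoids the closed `η`-neighbourhood of `G` has a free open crossing of `Ω_δ` between
`(ab)_δ` and `(cd)_δ`.  Proof: the open chain of left vertices (`lowerRun_chain_pathIn`) runs
from inside `C₂` to inside `C₀`; run extraction (`PathIn.exists_run`) between its last
`C₂`-contact and its next `C₀`-contact gives inside steps between two gates, which are
discrete-arc sites (`mem_discreteArc_of_contact`) once in `Ω_δ` (giant component, the gates
being `≥ r/2` apart); inside steps are `ω`-open since wired ones are excluded by the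
`η`-avoidance. -/
theorem lowerRun_kernel (R : ConformalRectangle) {E : DiscreteDobrushin} (hE : E.IsZdAdmissible)
    {C₀ C₂ : Set ℂ} {r : ℝ} (hC₀c : IsClosed C₀) (hC₂c : IsClosed C₂)
    (hC₀d : Disjoint C₀ R.carrier) (hC₂d : Disjoint C₂ R.carrier)
    (hsplit : E.Ω \ R.carrier ⊆ C₀ ∪ C₂) (hdist : ∀ z ∈ C₀, ∀ w ∈ C₂, r ≤ dist z w)
    (hfar₀ : ∀ z ∈ C₀, ∀ i : Fin 4, i ≠ 0 → r ≤ infDist z (R.arc i))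
    (hfar₂ : ∀ z ∈ C₂, ∀ i : Fin 4, i ≠ 2 → r ≤ infDist z (R.arc i))
    {p₀ p₁ : ℂ} {ε₀ : ℝ} (hb₀ : ball p₀ r ∩ E.Ω ⊆ C₂) (hb₁ : ball p₁ r ∩ E.Ω ⊆ C₀)
    (hε₀ : 2 * ε₀ ≤ dist p₀ p₁) (hε₀r : 2 * ε₀ ≤ r)
    (he₀ : ∃ e ∈ E.zdABEdges, dist (medialPoint E.δ e) p₀ < ε₀)
    (he₁ : ∃ e ∈ E.zdABEdges, dist (medialPoint E.δ e) p₁ < ε₀) (hδr : 4 * E.δ < r)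
    (hgiant : ∀ x y : meshVertices R.carrier E.δ, (meshVertexGraph R.carrier E.δ).Reachable x y →
      r / 2 ≤ dist (meshPoint E.δ (x : Site 2)) (meshPoint E.δ (y : Site 2)) →
      (x : Site 2) ∈ meshDomain R.carrier E.δ ∧ (y : Site 2) ∈ meshDomain R.carrier E.δ)
    {G : Set ℂ} {η : ℝ} (hGne : G.Nonempty) (hδη : 2 * E.δ < η)
    (hwired : ∀ x ∈ E.zdArcA, meshPoint E.δ x ∈ R.carrier → infDist (meshPoint E.δ x) G ≤ η / 2)
    {ω : BondConfig (Site 2)} (hω : Disjoint (range (medialExplorationCurve E ω)) (cthickening η G)) :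
    ω ∈ discreteCrossing R.carrier E.δ (R.arc 0) (R.arc 2) := by
  have hδ : 0 < E.δ := hE.delta_pos
  -- the safe set: sites `> η/2` away from `G`; it contains every site within `δ` of the trace
  set S : Set (Site 2) := {x | η / 2 < infDist (meshPoint E.δ x) G} with hSdef
  have hS : ∀ x : Site 2, ∀ e ∈ medialExploration E ω,
      dist (medialPoint E.δ e) (meshPoint E.δ x) ≤ E.δ → x ∈ S := by
    intro x e he hxe
    have hrange : medialPoint E.δ e ∈ range (medialExplorationCurve E ω) :=
      mem_range_polyline (List.mem_map_of_mem he)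
    have hnot : medialPoint E.δ e ∉ cthickening η G := Set.disjoint_left.1 hω hrange
    rw [mem_cthickening_iff, not_le] at hnot
    have hη' : η < infDist (medialPoint E.δ e) G := by
      rw [infDist]
      exact (ENNReal.ofReal_lt_iff_lt_toReal (by linarith) (infEDist_ne_top hGne)).1 hnot
    have := infDist_le_infDist_add_dist (x := medialPoint E.δ e) (y := meshPoint E.δ x) (s := G)
    show η / 2 < infDist (meshPoint E.δ x) G
    linarith
  -- the open chain
  obtain ⟨u, v, e₁, e₂, hAB, hu₁, hv₂, huΩ, hvΩ, hpath⟩ := lowerRun_chain_pathIn E hE ω S hS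
  -- orientation: one end in `C₂`, the other in `C₀`
  obtain ⟨a₀, ha₀, hd₀⟩ := he₀
  obtain ⟨a₁, ha₁, hd₁⟩ := he₁
  have ha₀' := hAB ha₀
  have ha₁' := hAB ha₁
  simp only [mem_insert_iff, mem_singleton_iff] at ha₀' ha₁'
  have hne : a₀ ≠ a₁ := by
    rintro rfl
    have := dist_triangle p₀ (medialPoint E.δ a₀) p₁
    rw [dist_comm p₀ (medialPoint E.δ a₀)] at this
    linarith
  have hnear : ∀ {e : MedialVertex} {p : ℂ} {w : Site 2}, dist (medialPoint E.δ e) p < ε₀ →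
      dist (medialPoint E.δ e) (meshPoint E.δ w) ≤ E.δ → meshPoint E.δ w ∈ ball p r := by
    intro e p w hep hew
    rw [mem_ball]
    have := dist_triangle (meshPoint E.δ w) (medialPoint E.δ e) p
    rw [dist_comm (meshPoint E.δ w) (medialPoint E.δ e)] at this
    linarith
  obtain ⟨u', v', hu'C, hv'C, hpath'⟩ : ∃ u' v' : Site 2, meshPoint E.δ u' ∈ C₂ ∧
      meshPoint E.δ v' ∈ C₀ ∧ PathIn (openGraph (E.bcBondConfig ω)) S u' v' := by
    rcases ha₀' with rfl | rfl
    · have ha₁e : a₁ = e₂ := by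
        rcases ha₁' with rfl | rfl
        · exact absurd rfl hne
        · rfl
      subst ha₁e
      exact ⟨u, v, hb₀ ⟨hnear hd₀ hu₁, huΩ⟩, hb₁ ⟨hnear hd₁ hv₂, hvΩ⟩, hpath⟩
    · have ha₁e : a₁ = e₁ := by
        rcases ha₁' with rfl | rfl
        · rfl
        · exact absurd rfl hne
      subst ha₁e
      exact ⟨v, u, hb₀ ⟨hnear hd₀ hv₂, hvΩ⟩, hb₁ ⟨hnear hd₁ hu₁, huΩ⟩, hpath.symm⟩
  clear hpath hu₁ hv₂ huΩ hvΩ ha₀ ha₁ hd₀ hd₁ hne hAB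
  -- the graphs of open steps and of inside open steps, the two contact relations
  set G' : SimpleGraph (Site 2) := openGraph (E.bcBondConfig ω) with hG'
  set Hin : SimpleGraph (Site 2) := SimpleGraph.fromRel fun p q : Site 2 =>
    meshPoint E.δ p ∈ R.carrier ∧ meshPoint E.δ q ∈ R.carrier ∧
      segment ℝ (meshPoint E.δ p) (meshPoint E.δ q) ⊆ closure R.carrier with hHin
  set H : SimpleGraph (Site 2) := G' ⊓ Hin with hH
  set L₀ : Site 2 → Site 2 → Prop := fun p q =>
    ∃ z ∈ segment ℝ (meshPoint E.δ p) (meshPoint E.δ q), z ∈ C₂ with hL₀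
  set L₂ : Site 2 → Site 2 → Prop := fun p q =>
    ∃ z ∈ segment ℝ (meshPoint E.δ p) (meshPoint E.δ q), z ∈ C₀ with hL₂
  have hHadj : ∀ p q, H.Adj p q ↔ G'.Adj p q ∧ meshPoint E.δ p ∈ R.carrier ∧
      meshPoint E.δ q ∈ R.carrier ∧
      segment ℝ (meshPoint E.δ p) (meshPoint E.δ q) ⊆ closure R.carrier := by
    intro p q
    simp only [hH, hHin, SimpleGraph.inf_adj, SimpleGraph.fromRel_adj]
    constructor
    · rintro ⟨hG, -, h | h⟩
      · exact ⟨hG, h⟩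
      · exact ⟨hG, h.2.1, h.1, segment_symm ℝ (meshPoint E.δ q) (meshPoint E.δ p) ▸ h.2.2⟩
    · rintro ⟨hG, h⟩
      exact ⟨hG, hG.ne, Or.inl h⟩
  have hGD : ∀ p q, G'.Adj p q → (meshGraph E.Ω E.δ).Adj p q ∧ p ∈ meshDomain E.Ω E.δ ∧
      q ∈ meshDomain E.Ω E.δ := fun p q h =>
    discreteDomainGraph_adj_iff.1 (E.bcBondConfig_subset ω ((openGraph_adj _ _ _).1 h).1)
  -- classification of open steps
  have hclass : ∀ p ∈ S, ∀ q ∈ S, G'.Adj p q → H.Adj p q ∨ L₀ p q ∨ L₂ p q := by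
    intro p _ q _ hpq
    obtain ⟨hmesh, hpD, hqD⟩ := hGD p q hpq
    have hpE : meshPoint E.δ p ∈ E.Ω := meshDomain_subset_meshVertices _ _ hpD
    have hqE : meshPoint E.δ q ∈ E.Ω := meshDomain_subset_meshVertices _ _ hqD
    have hsegE := (meshGraph_adj_iff.1 hmesh).2
    have hcollar : ∀ z ∈ segment ℝ (meshPoint E.δ p) (meshPoint E.δ q), z ∈ C₀ ∪ C₂ →
        L₀ p q ∨ L₂ p q := by
      rintro z hz (h | h)
      · exact Or.inr ⟨z, hz, h⟩
      · exact Or.inl ⟨z, hz, h⟩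
    by_cases hp : meshPoint E.δ p ∈ R.carrier
    · by_cases hq : meshPoint E.δ q ∈ R.carrier
      · by_cases hseg : segment ℝ (meshPoint E.δ p) (meshPoint E.δ q) ⊆ closure R.carrier
        · exact Or.inl ((hHadj p q).2 ⟨hpq, hp, hq, hseg⟩)
        · obtain ⟨z, hz, hzc⟩ := not_subset.1 hseg
          exact Or.inr (hcollar z hz
            (mem_of_mem_closure_of_not_mem_closure (hC₀c.union hC₂c) hsplit (hsegE hz) hzc))
      · exact Or.inr (hcollar _ (right_mem_segment ℝ _ _) (hsplit ⟨hqE, hq⟩))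
    · exact Or.inr (hcollar _ (left_mem_segment ℝ _ _) (hsplit ⟨hpE, hp⟩))
  have hu : ∀ b ∈ S, G'.Adj u' b → ¬ H.Adj u' b ∧ L₀ u' b := fun b _ hub =>
    ⟨fun h => Set.disjoint_left.1 hC₂d hu'C ((hHadj u' b).1 h).2.1,
      ⟨_, left_mem_segment ℝ _ _, hu'C⟩⟩
  have hv : ∀ a ∈ S, G'.Adj a v' → ¬ H.Adj a v' ∧ ¬ L₀ a v' := by
    intro a _ hav
    refine ⟨fun h => Set.disjoint_left.1 hC₀d hv'C ((hHadj a v').1 h).2.2.1, ?_⟩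
    rintro ⟨z, hz, hzC⟩
    have h1 : dist z (meshPoint E.δ v') ≤ E.δ := by
      have := dist_le_dist_of_mem_segment hz (right_mem_segment ℝ _ _)
      rwa [dist_meshPoint_of_adj (meshGraph_adj_iff.1 (hGD a v' hav).1).1, abs_of_pos hδ] at this
    have h2 := hdist _ hv'C _ hzC
    rw [dist_comm] at h2
    linarith
  have huv : u' ≠ v' := by
    intro h
    rw [h] at hu'C
    have := hdist _ hv'C _ hu'C
    rw [dist_self] at this
    linarith
  -- run extraction
  obtain ⟨a', a, b, b', -, ha'a, hnH, ⟨z₂, hz₂, hz₂C⟩, hrun, -, hbb', hnH', hnL₀, ⟨z₀, hz₀, hz₀C⟩⟩ :=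
    PathIn.exists_run (inf_le_left : H ≤ G') hclass hu hv huv hpath'
  obtain ⟨hmesha, -, haD⟩ := hGD a' a ha'a
  obtain ⟨hmeshb, -, -⟩ := hGD b b' hbb'
  have hzda : (zdGraph 2).Adj a a' := (meshGraph_adj_iff.1 hmesha).1.symm
  have hzdb : (zdGraph 2).Adj b b' := (meshGraph_adj_iff.1 hmeshb).1
  have haz : dist (meshPoint E.δ a) z₂ ≤ E.δ := by
    have := dist_le_dist_of_mem_segment (right_mem_segment ℝ _ _) hz₂
    rwa [dist_meshPoint_of_adj hzda.symm, abs_of_pos hδ] at this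
  have hbz : dist (meshPoint E.δ b) z₀ ≤ E.δ := by
    have := dist_le_dist_of_mem_segment (left_mem_segment ℝ _ _) hz₀
    rwa [dist_meshPoint_of_adj hzdb, abs_of_pos hδ] at this
  -- the gates have mesh points in `Ω`
  have haΩ : meshPoint E.δ a ∈ R.carrier := by
    by_cases hab : a = b
    · subst hab
      by_contra haΩ
      rcases hsplit ⟨meshDomain_subset_meshVertices _ _ haD, haΩ⟩ with h0 | h2
      · have := hdist _ h0 _ hz₂C
        linarith
      · exact hnL₀ ⟨_, left_mem_segment ℝ _ _, h2⟩
    · obtain ⟨c, -, hac⟩ := hrun.exists_adj_head hab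
      exact ((hHadj a c).1 hac).2.1
  have hbΩ : meshPoint E.δ b ∈ R.carrier := by
    by_cases hab : a = b
    · exact hab ▸ haΩ
    · obtain ⟨c, -, hcb⟩ := hrun.exists_adj_last hab
      exact ((hHadj c b).1 hcb).2.2.1
  -- the gates are `≥ r/2` apart, hence in the giant component
  have habd : r / 2 ≤ dist (meshPoint E.δ a) (meshPoint E.δ b) := by
    have h1 := hdist z₀ hz₀C z₂ hz₂C
    have := dist_triangle4 z₀ (meshPoint E.δ b) (meshPoint E.δ a) z₂
    rw [dist_comm z₀ (meshPoint E.δ b), dist_comm (meshPoint E.δ b) (meshPoint E.δ a)] at this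
    linarith
  have hHmesh : ∀ p q, H.Adj p q → (meshGraph R.carrier E.δ).Adj p q ∧
      meshPoint E.δ p ∈ R.carrier ∧ meshPoint E.δ q ∈ R.carrier := by
    intro p q h
    obtain ⟨hG, hp, hq, hseg⟩ := (hHadj p q).1 h
    exact ⟨meshGraph_adj_iff.2 ⟨(meshGraph_adj_iff.1 (hGD p q hG).1).1, hseg⟩, hp, hq⟩
  obtain ⟨hbΩ', hreach⟩ := reachable_meshVertexGraph_of_pathIn hHmesh hrun haΩ
  obtain ⟨haM, hbM⟩ := hgiant ⟨a, haΩ⟩ ⟨b, hbΩ'⟩ hreach habd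
  -- the gates are discrete-arc sites
  have hout : meshPoint E.δ a' ∉ R.carrier ∨
      ¬ segment ℝ (meshPoint E.δ a) (meshPoint E.δ a') ⊆ closure R.carrier := by
    by_contra hcon
    rw [not_or, not_not, not_not] at hcon
    exact hnH ((hHadj a' a).2 ⟨ha'a, hcon.1, haΩ, by rw [segment_symm]; exact hcon.2⟩)
  have hout' : meshPoint E.δ b' ∉ R.carrier ∨
      ¬ segment ℝ (meshPoint E.δ b) (meshPoint E.δ b') ⊆ closure R.carrier := by
    by_contra hcon
    rw [not_or, not_not, not_not] at hcon
    exact hnH' ((hHadj b b').2 ⟨hbb', hbΩ, hcon.1, hcon.2⟩)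
  have ha_arc : a ∈ discreteArc R.carrier E.δ (R.arc 2) :=
    mem_discreteArc_of_contact R hδ (by linarith) hC₂d hfar₂ haM hzda hout
      (by rw [segment_symm]; exact hz₂) hz₂C
  have hb_arc : b ∈ discreteArc R.carrier E.δ (R.arc 0) :=
    mem_discreteArc_of_contact R hδ (by linarith) hC₀d hfar₀ hbM hzdb hout' hz₀ hz₀C
  -- inside open steps are `ω`-open (wired ones are excluded by the `η`-avoidance)
  have hHω : ∀ p ∈ S, ∀ q ∈ S, H.Adj p q →
      (meshGraph R.carrier E.δ).Adj p q ∧ meshPoint E.δ q ∈ R.carrier ∧ s(p, q) ∈ ω := by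
    intro p hpS q _ hpq
    obtain ⟨hG, hp, hq, hseg⟩ := (hHadj p q).1 hpq
    refine ⟨meshGraph_adj_iff.2 ⟨(meshGraph_adj_iff.1 (hGD p q hG).1).1, hseg⟩, hq, ?_⟩
    obtain ⟨hbc, -⟩ := (openGraph_adj _ _ _).1 hG
    rcases (E.mem_bcBondConfig_iff.1 hbc).2 with hw | ⟨hωm, -⟩
    · have h1 := hwired p (hw p (Sym2.mem_mk_left _ _)) hp
      have h2 : η / 2 < infDist (meshPoint E.δ p) G := hpS
      exact absurd h1 (not_le.2 h2)
    · exact hωm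
  obtain ⟨hreachω, -⟩ := reachable_openGraph_inf_of_pathIn hHω hrun haM
  exact ⟨b, hb_arc, a, ha_arc, hreachω.symm⟩


/-! ### The stub -/

/-- **STUB B of line `collar-touch-sandwich` — the lower run inclusion `LowerRun`.**  Under
`LowerCollarGeom R D G`, for every discretisation family `Λ` of `D` and every `η > 0`, for all
small meshes `δ` every configuration whose medial exploration trace in `Λ δ` stays `η`-away from
the touch set `G` has a free open crossing of `Ω_δ` from `(ab)_δ` to `(cd)_δ`.  Proof: intersect
the eventualities (positive small mesh, admissibility, `A`–`B` edge midpoints at the marks,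
wired sites near `G`, giant-component threshold of `Ω_δ`) and apply the deterministic kernel
`lowerRun_kernel` to the normalised collar splitting `LowerCollarGeom.exists_closed_split`. -/
theorem stub_lowerRun : LowerRun := by
  intro R D G hgeom Λ hΛ η hη
  obtain ⟨C₀, C₂, r, hr, hC₀c, hC₂c, hC₀d, hC₂d, hsplit, hdist, hfar₀, hfar₂, hb₀, hb₁⟩ :=
    hgeom.exists_closed_split
  have hpt : 0 < dist (D.pt 0) (D.pt 1) :=
    dist_pos.2 fun h => absurd (D.pt_injective h) (by decide)
  set ε₀ := min (r / 2) (dist (D.pt 0) (D.pt 1) / 2) with hε₀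
  have hε₀pos : 0 < ε₀ := by positivity
  have hε₀r : 2 * ε₀ ≤ r := by
    have := min_le_left (r / 2) (dist (D.pt 0) (D.pt 1) / 2)
    linarith
  have hε₀d : 2 * ε₀ ≤ dist (D.pt 0) (D.pt 1) := by
    have := min_le_right (r / 2) (dist (D.pt 0) (D.pt 1) / 2)
    linarith
  obtain ⟨δ₀, hδ₀, hgiant⟩ :=
    R.toJordanDomain.exists_mem_meshDomain_and_mem_of_reachable (half_pos hr)
  have hGne : G.Nonempty := lowerCollarGeom_touch_nonempty hgeom
  filter_upwards [eventually_mesh_pos, eventually_mesh_lt (by positivity : 0 < r / 4),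
    eventually_mesh_lt (half_pos hη), eventually_mesh_lt hδ₀, hΛ.eventually_isZdAdmissible,
    eventually_zdABEdges_near_pt hΛ hε₀pos, lowerRun_wired_near_touch R D G hgeom Λ hΛ η hη]
    with δ hδ hδr hδη hδδ₀ hE hmarks hwired
  intro ω hω
  have hΩ := hΛ.Ω_eq δ
  have hδE := hΛ.δ_eq δ
  have key := lowerRun_kernel (E := Λ δ) (p₀ := D.pt 0) (p₁ := D.pt 1) (ε₀ := ε₀) (G := G)
    (η := η) (ω := ω) R hE hC₀c hC₂c hC₀d hC₂d
    (by rw [hΩ]; exact hsplit) hdist hfar₀ hfar₂ (by rw [hΩ]; exact hb₀) (by rw [hΩ]; exact hb₁)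
    hε₀d hε₀r (by rw [hδE]; exact hmarks 0) (by rw [hδE]; exact hmarks 1) (by rw [hδE]; linarith)
    (by rw [hδE]; exact fun x y hxy hd => hgiant δ hδ hδδ₀ x y hxy hd) hGne (by rw [hδE]; linarith)
    (by rw [hδE]; exact hwired) hω
  rwa [hδE] at key

end Summit.CriticalPhenomena.CardyFormulaZ2.Cruxes.SLESixFamiliesGiveCardy.CollarTouchSandwich

end
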